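import Literature.AlgebraicTopology.KTheory.BottIndex2
import Mathlib.Analysis.Normed.Ring.Units
import HarnessLib

/-!
# The index map of Bott periodicity, III: the index `ind(g) ∈ K⁰(X)` of an invertible matrix over `X × S¹`

Husemöller, *Fibre Bundles*, Ch. 11 §5 (the map `ν`, normalised): for an invertible
`g ∈ M_n(C(X × S¹, ℂ))`, an *admissible approximant* is a matrix Laurent polynomial `L` with
`‖g - L‖ < ε₀(g) = 1/(2(‖g⁻¹‖ + 1))` (`IsApprox`); any two admissible approximants give the same
`J` (`Jval_eq_of_isApprox`, by the segment homotopy over `X × [0,1]`, `segA`), whence the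
well-defined **`indGL g`** (`indGL_eq`: computed by any admissible approximant and any admissible
`(s, d)`), with `indGL_one = 0`, naturality `pullback_indGL`, homotopy invariance
`indGL_slice_eq`, and the computation **`indGL_sp : ind(z P + (1 - P)) = [P]`**.

Everything is proved; no named facts.

## References

* D. Husemöller, *Fibre Bundles*, 3rd ed. (1994) [HusemollerFibreBundles1994]: Ch. 11 §5
  (Notation 5.1, Props. 5.2, 5.3, Thm. 5.4), Cor. 2.8.
-/

noncomputable section

open Set Metric unitInterval Complex

namespace Literature.AlgebraicTopology.KTheory

open Literature.RingTheory.KTheory Matrix Pencil Linearization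

universe u

variable {X : Type u} [TopologicalSpace X] [CompactSpace X] [T2Space X]
variable {n : ℕ}

section Norms

attribute [local instance] Matrix.linftyOpNormedRing Matrix.linftyOpNormedAlgebra

/-! ### The admissibility radius `ε₀(g)` -/

/-- `ε₀(g) = 1 / (2 (‖g⁻¹‖ + 1))`. [folklore] -/
def eps0 (g : Matrix (Fin n) (Fin n) C(↥(pieceUp X ∩ pieceDn X), ℂ)) : ℝ := (2 * (‖Ring.inverse g‖ + 1))⁻¹

omit [T2Space X] in
/-- Auxiliary statement for the index map of Bott periodicity. [folklore] -/
theorem eps0_pos (g : Matrix (Fin n) (Fin n) C(↥(pieceUp X ∩ pieceDn X), ℂ)) : 0 < eps0 g := by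
  rw [eps0]; positivity

omit [T2Space X] in
/-- `ε₀` is antitone in `‖g⁻¹‖`. [folklore] -/
theorem eps0_le_eps0 {g : Matrix (Fin n) (Fin n) C(↥(pieceUp X ∩ pieceDn X), ℂ)} {Y : Type*} [TopologicalSpace Y] [CompactSpace Y]
    {g' : Matrix (Fin n) (Fin n) C(↥(pieceUp Y ∩ pieceDn Y), ℂ)} (h : ‖Ring.inverse g'‖ ≤ ‖Ring.inverse g‖) : eps0 g ≤ eps0 g' := by
  rw [eps0, eps0]
  gcongr

omit [T2Space X] in
/-- **A matrix within `2 ε₀(g)` of the unit `g` is a unit.** [folklore] -/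
theorem isUnit_of_norm_sub_lt {g M : Matrix (Fin n) (Fin n) C(↥(pieceUp X ∩ pieceDn X), ℂ)} (hg : IsUnit g) (h : ‖M - g‖ < 2 * eps0 g) :
    IsUnit M := by
  rcases subsingleton_or_nontrivial (Matrix (Fin n) (Fin n) C(↥(pieceUp X ∩ pieceDn X), ℂ)) with hn | hn
  · exact isUnit_of_subsingleton M
  · obtain ⟨u, rfl⟩ := hg
    have hpos : 0 < ‖(↑u⁻¹ : Matrix (Fin n) (Fin n) C(↥(pieceUp X ∩ pieceDn X), ℂ))‖ := Units.norm_pos u⁻¹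
    have h2 : 2 * eps0 (u : Matrix (Fin n) (Fin n) C(↥(pieceUp X ∩ pieceDn X), ℂ)) < ‖(↑u⁻¹ : Matrix (Fin n) (Fin n) C(↥(pieceUp X ∩ pieceDn X), ℂ))‖⁻¹ := by
      rw [eps0, Ring.inverse_unit, mul_inv, ← mul_assoc, mul_inv_cancel₀ two_ne_zero, one_mul]
      exact inv_strictAnti₀ hpos (lt_add_one _)
    exact ⟨Units.ofNearby u M (h.trans h2), rfl⟩

end Norms

/-! ### Base change along `f : X' → X` -/

section BaseChange

variable {X' : Type*} [TopologicalSpace X'] [CompactSpace X'] [T2Space X']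

variable (X) in
/-- The map of overlaps induced by `f : X' → X`. [folklore] -/
abbrev ovlMap (f : C(X', X)) : C(↥(pieceUp X' ∩ pieceDn X'), ↥(pieceUp X ∩ pieceDn X)) :=
  restrictMap (baseMap f) (mapsTo_inter (mapsTo_baseMap_pieceUp f) (mapsTo_baseMap_pieceDn f))

omit [CompactSpace X] [T2Space X] [CompactSpace X'] [T2Space X'] in
/-- Auxiliary statement for the index map of Bott periodicity. [folklore] -/
theorem comapRingHom_ovlMap_zA (f : C(X', X)) : comapRingHom (ovlMap X f) zA = zA := rfl

omit [CompactSpace X] [T2Space X] [CompactSpace X'] [T2Space X'] in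
/-- Auxiliary statement for the index map of Bott periodicity. [folklore] -/
theorem comapRingHom_ovlMap_zU_zpow (f : C(X', X)) (k : ℤ) :
    comapRingHom (ovlMap X f) (((zU ^ k : (C(↥(pieceUp X ∩ pieceDn X), ℂ))ˣ) : C(_, ℂ))) = ((zU ^ k : (C(↥(pieceUp X' ∩ pieceDn X'), ℂ))ˣ) : C(_, ℂ)) := by
  have h1 : Units.map (comapRingHom (ovlMap X f) : C(↥(pieceUp X ∩ pieceDn X), ℂ) →* C(↥(pieceUp X' ∩ pieceDn X'), ℂ)) zU = zU :=
    Units.ext rfl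
  rw [← h1, ← map_zpow, Units.coe_map]; rfl

omit [CompactSpace X] [T2Space X] [CompactSpace X'] [T2Space X'] in
/-- **Laurent polynomials are natural under base change.** [folklore] -/
theorem laurentMatrix_map {ι' : Type} [Fintype ι'] (A : ι' → Matrix (Fin n) (Fin n) C(X, ℂ)) (e : ι' → ℤ) (f : C(X', X)) :
    (laurentMatrix A e).map (comapRingHom (ovlMap X f)) = laurentMatrix (fun i ↦ (A i).map (comapRingHom f)) e := by
  ext p q : 1
  rw [Matrix.map_apply, laurentMatrix_apply, laurentMatrix_apply, map_sum]
  refine Finset.sum_congr rfl fun i _ ↦ ?_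
  rw [map_mul, comapRingHom_ovlMap_zU_zpow]
  rfl

omit [CompactSpace X] [T2Space X] [CompactSpace X'] [T2Space X'] in
/-- `lcoeff` is natural under base change. [folklore] -/
theorem lcoeff_map {ι' : Type} [Fintype ι'] (A : ι' → Matrix (Fin n) (Fin n) C(X, ℂ)) (e : ι' → ℤ) (s d : ℕ) (f : C(X', X)) (k : Fin (d + 1)) :
    (lcoeff A e s d k).map (comapRingHom f) = lcoeff (fun i ↦ (A i).map (comapRingHom f)) e s d k := by
  simp only [lcoeff]
  exact map_sum (AddMonoidHom.mapMatrix (comapRingHom f : C(X, ℂ) →+* C(X', ℂ)).toAddMonoidHom) _ _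

omit [CompactSpace X] [T2Space X] [CompactSpace X'] [T2Space X'] in
/-- Auxiliary statement for the index map of Bott periodicity. [folklore] -/
theorem linA_map {d : ℕ} (f : C(X', X)) : (linA X d n).map (comapRingHom f) = linA X' d n := by
  rw [linA, linA, ← Matrix.comp_map_map]
  congr 1
  ext r c : 1
  simp only [LmatB, Matrix.map_apply, Matrix.of_apply]
  split_ifs
  · rw [Matrix.map_neg _ (map_neg _), Matrix.map_one _ (map_zero _) (map_one _)]
  · exact Matrix.map_zero _ (map_zero _)

omit [CompactSpace X] [T2Space X] [CompactSpace X'] [T2Space X'] in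
/-- Auxiliary statement for the index map of Bott periodicity. [folklore] -/
theorem linB_map {d : ℕ} (a : Fin (d + 1) → Matrix (Fin n) (Fin n) C(X, ℂ)) (f : C(X', X)) :
    (linB a).map (comapRingHom f) = linB fun k ↦ (a k).map (comapRingHom f) := by
  rw [linB, linB, ← Matrix.comp_map_map]
  congr 1
  exact LmatA_map a (comapRingHom f)

omit [CompactSpace X] [T2Space X] [CompactSpace X'] [T2Space X'] in
/-- Auxiliary statement for the index map of Bott periodicity. [folklore] -/
theorem polyClutch_map {d : ℕ} (a : Fin (d + 1) → Matrix (Fin n) (Fin n) C(X, ℂ)) (f : C(X', X)) :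
    (polyClutch a).map (comapRingHom (ovlMap X f)) = polyClutch fun k ↦ (a k).map (comapRingHom f) := by
  rw [polyClutch, polyEval_map]; rfl

/-- **`J` is natural**: `f^* J(A, e; s, d) = J(f^*A, e; s, d)` (when the linearisation over `X` is invertible). [cite: HusemollerFibreBundles1994, Ch. 11 Prop. 5.2] -/
theorem pullback_Jval {ι' : Type} [Fintype ι'] (A : ι' → Matrix (Fin n) (Fin n) C(X, ℂ)) (e : ι' → ℤ) (s d : ℕ) (f : C(X', X))
    (h : IsUnit (linClutch (linA X d n) (linB (lcoeff A e s d)))) :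
    pullback f (Jval A e s d) = Jval (fun i ↦ (A i).map (comapRingHom f)) e s d := by
  have h' := isUnit_linClutch_map h f
  rw [linA_map, linB_map] at h'
  have e1 : (fun k ↦ (lcoeff A e s d k).map (comapRingHom f)) = lcoeff (fun i ↦ (A i).map (comapRingHom f)) e s d :=
    funext fun k ↦ lcoeff_map A e s d f k
  rw [e1] at h'
  have hn : pullback f ((s * n : ℕ) : K0 X) = (s * n : ℕ) := map_natCast (pullbackRingHom f) _
  rw [Jval_eq _ h, Jval_eq _ h', map_sub, hn, pullback_plusClass _ _ h f (isUnit_linClutch_map h f)]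
  congr 1
  exact plusClass_congr _ _ (linA_map f) (by rw [linB_map, e1])

end BaseChange

/-! ### Admissible approximants -/

section Approx

attribute [local instance] Matrix.linftyOpNormedRing Matrix.linftyOpNormedAlgebra

/-- `(A, e)` is an **admissible Laurent approximant** of `g`: `‖g - ∑ z^{eᵢ} Aᵢ‖ < ε₀(g)`. [cite: HusemollerFibreBundles1994, Ch. 11 Notation 5.1] -/
def IsApprox (g : Matrix (Fin n) (Fin n) C(↥(pieceUp X ∩ pieceDn X), ℂ)) {ι' : Type} [Fintype ι'] (A : ι' → Matrix (Fin n) (Fin n) C(X, ℂ))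
    (e : ι' → ℤ) : Prop :=
  ‖g - laurentMatrix A e‖ < eps0 g

omit [T2Space X] in
/-- Auxiliary statement for the index map of Bott periodicity. [folklore] -/
theorem IsApprox.isUnit {g : Matrix (Fin n) (Fin n) C(↥(pieceUp X ∩ pieceDn X), ℂ)} (hg : IsUnit g) {ι' : Type} [Fintype ι']
    {A : ι' → Matrix (Fin n) (Fin n) C(X, ℂ)} {e : ι' → ℤ} (h : IsApprox g A e) : IsUnit (laurentMatrix A e) :=
  isUnit_of_norm_sub_lt hg (by rw [norm_sub_rev]; exact h.trans (by linarith [eps0_pos g]))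

/-- Auxiliary statement for the index map of Bott periodicity. [folklore] -/
theorem exists_isApprox (g : Matrix (Fin n) (Fin n) C(↥(pieceUp X ∩ pieceDn X), ℂ)) :
    ∃ (ι' : Type) (_ : Fintype ι') (A : ι' → Matrix (Fin n) (Fin n) C(X, ℂ)) (e : ι' → ℤ), IsApprox g A e :=
  exists_laurentMatrix_near g (eps0_pos g)

omit [T2Space X] in
/-- `‖(1 - s) • N‖ ≤ ‖N‖`. [folklore] -/
theorem linfty_opNorm_one_sub_sCoord_smul_le {m : Type*} [Fintype m] [DecidableEq m]
    (N : Matrix m m C(↥(pieceUp (X × I) ∩ pieceDn (X × I)), ℂ)) : ‖(1 - sCoord (X := X)) • N‖ ≤ ‖N‖ := by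
  refine linfty_opNorm_mono N _ fun i j ↦ ?_
  rw [Matrix.smul_apply, smul_eq_mul, ContinuousMap.norm_le _ (norm_nonneg _)]
  intro z
  rw [ContinuousMap.mul_apply, norm_mul]
  have h1 : ‖(1 - sCoord (X := X)) z‖ ≤ 1 := by
    rw [ContinuousMap.sub_apply, ContinuousMap.one_apply, sCoord_apply, ← Complex.ofReal_one, ← Complex.ofReal_sub, Complex.norm_real,
      Real.norm_eq_abs, abs_le]
    constructor <;> linarith [z.1.1.2.2.1, z.1.1.2.2.2]
  calc ‖(1 - sCoord (X := X)) z‖ * ‖N i j z‖ ≤ 1 * ‖N i j‖ := by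
        gcongr
        exact (N i j).norm_coe_le_norm z
    _ = ‖N i j‖ := one_mul _

/-! ### The segment between two approximants, as a Laurent polynomial over `X × [0,1]` -/

variable {ι₁ ι₂ : Type} [Fintype ι₁] [Fintype ι₂]

/-- The coefficients `((1-t) A¹ᵢ, t A²ⱼ)` over `X × [0,1]`. [cite: HusemollerFibreBundles1994, Ch. 11 Prop. 5.3] -/
def segA (A₁ : ι₁ → Matrix (Fin n) (Fin n) C(X, ℂ)) (A₂ : ι₂ → Matrix (Fin n) (Fin n) C(X, ℂ)) :
    ι₁ ⊕ ι₂ → Matrix (Fin n) (Fin n) C(X × I, ℂ) :=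
  Sum.elim (fun i ↦ (1 - tY X) • liftY (A₁ i)) (fun i ↦ tY X • liftY (A₂ i))

omit [CompactSpace X] [T2Space X] in
/-- The segment Laurent polynomial is `(1 - s) L₁ + s L₂` (lifted). [cite: HusemollerFibreBundles1994, Ch. 11 Prop. 5.3] -/
theorem laurentMatrix_segA (A₁ : ι₁ → Matrix (Fin n) (Fin n) C(X, ℂ)) (A₂ : ι₂ → Matrix (Fin n) (Fin n) C(X, ℂ)) (e₁ : ι₁ → ℤ) (e₂ : ι₂ → ℤ) :
    laurentMatrix (segA A₁ A₂) (Sum.elim e₁ e₂) =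
      (1 - sCoord (X := X)) • (laurentMatrix A₁ e₁).map (comapRingHom fstOverlap) + sCoord (X := X) • (laurentMatrix A₂ e₂).map (comapRingHom fstOverlap) := by
  ext p q : 1
  rw [laurentMatrix_apply, Fintype.sum_sum_type, Matrix.add_apply, Matrix.smul_apply, Matrix.smul_apply, laurentMatrix_map, laurentMatrix_map,
    laurentMatrix_apply, laurentMatrix_apply, smul_eq_mul, smul_eq_mul, Finset.mul_sum, Finset.mul_sum]
  congr 1 <;> refine Finset.sum_congr rfl fun i _ ↦ ?_
  · simp only [segA, Sum.elim_inl, Matrix.smul_apply, Matrix.map_apply, smul_eq_mul, map_mul, mul_assoc]; rfl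
  · simp only [segA, Sum.elim_inr, Matrix.smul_apply, Matrix.map_apply, smul_eq_mul, map_mul, mul_assoc]; rfl

omit [T2Space X] in
/-- **The segment between two admissible approximants of a unit stays invertible.** [cite: HusemollerFibreBundles1994, Ch. 11 Prop. 5.3] -/
theorem isUnit_laurentMatrix_segA {g : Matrix (Fin n) (Fin n) C(↥(pieceUp X ∩ pieceDn X), ℂ)} (hg : IsUnit g)
    {A₁ : ι₁ → Matrix (Fin n) (Fin n) C(X, ℂ)} {A₂ : ι₂ → Matrix (Fin n) (Fin n) C(X, ℂ)} {e₁ : ι₁ → ℤ} {e₂ : ι₂ → ℤ}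
    (h₁ : IsApprox g A₁ e₁) (h₂ : IsApprox g A₂ e₂) : IsUnit (laurentMatrix (segA A₁ A₂) (Sum.elim e₁ e₂)) := by
  have hG : IsUnit (g.map (comapRingHom (fstOverlap (X := X)))) := hg.map (RingHom.mapMatrix _)
  -- `‖G⁻¹‖ ≤ ‖g⁻¹‖`
  have hinv : ‖Ring.inverse (g.map (comapRingHom (fstOverlap (X := X))))‖ ≤ ‖Ring.inverse g‖ := by
    obtain ⟨u, rfl⟩ := hg
    have h1 : (↑u : Matrix (Fin n) (Fin n) _).map (comapRingHom (fstOverlap (X := X))) * (↑u⁻¹ : Matrix (Fin n) (Fin n) _).map (comapRingHom (fstOverlap (X := X))) = 1 := by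
      rw [← Matrix.map_mul, Units.mul_inv, Matrix.map_one _ (map_zero _) (map_one _)]
    have h2 : (↑u⁻¹ : Matrix (Fin n) (Fin n) _).map (comapRingHom (fstOverlap (X := X))) * (↑u : Matrix (Fin n) (Fin n) _).map (comapRingHom (fstOverlap (X := X))) = 1 := by
      rw [← Matrix.map_mul, Units.inv_mul, Matrix.map_one _ (map_zero _) (map_one _)]
    rw [Ring.inverse_unit u, Ring.inverse_unit ⟨_, _, h1, h2⟩]
    exact linfty_opNorm_map_comapRingHom_le _ _
  refine isUnit_of_norm_sub_lt hG ?_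
  have hdecomp : laurentMatrix (segA A₁ A₂) (Sum.elim e₁ e₂) - g.map (comapRingHom (fstOverlap (X := X))) =
      (1 - sCoord (X := X)) • ((laurentMatrix A₁ e₁ - g).map (comapRingHom fstOverlap)) + sCoord (X := X) • ((laurentMatrix A₂ e₂ - g).map (comapRingHom fstOverlap)) := by
    rw [laurentMatrix_segA, Matrix.map_sub _ (map_sub _), Matrix.map_sub _ (map_sub _)]
    ext p q : 1
    simp only [Matrix.sub_apply, Matrix.add_apply, Matrix.smul_apply, smul_eq_mul]
    ring
  rw [hdecomp]
  calc ‖(1 - sCoord (X := X)) • ((laurentMatrix A₁ e₁ - g).map (comapRingHom fstOverlap)) + sCoord (X := X) • ((laurentMatrix A₂ e₂ - g).map (comapRingHom fstOverlap))‖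
      ≤ ‖(laurentMatrix A₁ e₁ - g).map (comapRingHom (fstOverlap (X := X)))‖ + ‖(laurentMatrix A₂ e₂ - g).map (comapRingHom (fstOverlap (X := X)))‖ :=
        (norm_add_le _ _).trans (add_le_add (linfty_opNorm_one_sub_sCoord_smul_le _) (linfty_opNorm_sCoord_smul_le _))
    _ ≤ ‖laurentMatrix A₁ e₁ - g‖ + ‖laurentMatrix A₂ e₂ - g‖ :=
        add_le_add (linfty_opNorm_map_comapRingHom_le _ _) (linfty_opNorm_map_comapRingHom_le _ _)
    _ < eps0 g + eps0 g := by rw [norm_sub_rev, norm_sub_rev (laurentMatrix A₂ e₂)]; exact add_lt_add h₁ h₂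
    _ = 2 * eps0 g := by ring
    _ ≤ 2 * eps0 (g.map (comapRingHom (fstOverlap (X := X)))) := by gcongr; exact eps0_le_eps0 hinv

omit [CompactSpace X] [T2Space X] [Fintype ι₁] [Fintype ι₂] in
/-- Auxiliary statement for the index map of Bott periodicity. [folklore] -/
theorem segA_slice_zero (A₁ : ι₁ → Matrix (Fin n) (Fin n) C(X, ℂ)) (A₂ : ι₂ → Matrix (Fin n) (Fin n) C(X, ℂ)) :
    (fun i ↦ (segA A₁ A₂ i).map (comapRingHom (sliceIncl 0))) = Sum.elim A₁ (fun _ ↦ 0) := by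
  funext i
  rcases i with i | i
  · ext p q x
    simp [segA, liftY, tY]
  · ext p q x
    simp [segA, liftY, tY]

omit [CompactSpace X] [T2Space X] [Fintype ι₁] [Fintype ι₂] in
/-- Auxiliary statement for the index map of Bott periodicity. [folklore] -/
theorem segA_slice_one (A₁ : ι₁ → Matrix (Fin n) (Fin n) C(X, ℂ)) (A₂ : ι₂ → Matrix (Fin n) (Fin n) C(X, ℂ)) :
    (fun i ↦ (segA A₁ A₂ i).map (comapRingHom (sliceIncl 1))) = Sum.elim (fun _ ↦ 0) A₂ := by
  funext i
  rcases i with i | i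
  · ext p q x
    simp [segA, liftY, tY]
  · ext p q x
    simp [segA, liftY, tY]

omit [CompactSpace X] [T2Space X] in
/-- Auxiliary statement for the index map of Bott periodicity. [folklore] -/
theorem lcoeff_sum_elim_zero_right (A₁ : ι₁ → Matrix (Fin n) (Fin n) C(X, ℂ)) (e₁ : ι₁ → ℤ) (e₂ : ι₂ → ℤ) (s d : ℕ) :
    lcoeff (Sum.elim A₁ (fun _ : ι₂ ↦ (0 : Matrix (Fin n) (Fin n) C(X, ℂ)))) (Sum.elim e₁ e₂) s d = lcoeff A₁ e₁ s d := by
  funext k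
  rw [lcoeff, lcoeff, Finset.sum_filter, Finset.sum_filter, Fintype.sum_sum_type]
  simp

omit [CompactSpace X] [T2Space X] in
/-- Auxiliary statement for the index map of Bott periodicity. [folklore] -/
theorem lcoeff_sum_elim_zero_left (A₂ : ι₂ → Matrix (Fin n) (Fin n) C(X, ℂ)) (e₁ : ι₁ → ℤ) (e₂ : ι₂ → ℤ) (s d : ℕ) :
    lcoeff (Sum.elim (fun _ : ι₁ ↦ (0 : Matrix (Fin n) (Fin n) C(X, ℂ))) A₂) (Sum.elim e₁ e₂) s d = lcoeff A₂ e₂ s d := by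
  funext k
  rw [lcoeff, lcoeff, Finset.sum_filter, Finset.sum_filter, Fintype.sum_sum_type]
  simp

omit [CompactSpace X] [T2Space X] in
/-- `J` depends on `(A, e)` only through the coefficients. [folklore] -/
theorem Jval_congr_lcoeff [CompactSpace X] [T2Space X] {ι' ι'' : Type} [Fintype ι'] [Fintype ι''] {A : ι' → Matrix (Fin n) (Fin n) C(X, ℂ)} {e : ι' → ℤ}
    {A' : ι'' → Matrix (Fin n) (Fin n) C(X, ℂ)} {e' : ι'' → ℤ} {s d : ℕ} (hl : lcoeff A e s d = lcoeff A' e' s d) :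
    Jval A e s d = Jval A' e' s d := by
  by_cases h : IsUnit (linClutch (linA X d n) (linB (lcoeff A e s d)))
  · have h' : IsUnit (linClutch (linA X d n) (linB (lcoeff A' e' s d))) := by rw [← hl]; exact h
    rw [Jval_eq _ h, Jval_eq _ h']
    congr 1
    exact plusClass_congr h h' rfl (by rw [hl])
  · have h' : ¬ IsUnit (linClutch (linA X d n) (linB (lcoeff A' e' s d))) := by rwa [← hl]
    rw [Jval, dif_neg h, Jval, dif_neg h']

/-- **Two admissible approximants of the same unit give the same `J`.** [cite: HusemollerFibreBundles1994, Ch. 11 Prop. 5.3] -/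
theorem Jval_eq_of_isApprox {g : Matrix (Fin n) (Fin n) C(↥(pieceUp X ∩ pieceDn X), ℂ)} (hg : IsUnit g)
    {A₁ : ι₁ → Matrix (Fin n) (Fin n) C(X, ℂ)} {A₂ : ι₂ → Matrix (Fin n) (Fin n) C(X, ℂ)} {e₁ : ι₁ → ℤ} {e₂ : ι₂ → ℤ}
    (h₁ : IsApprox g A₁ e₁) (h₂ : IsApprox g A₂ e₂) {s₁ d₁ s₂ d₂ : ℕ} (hs₁ : Adm e₁ s₁ d₁) (hs₂ : Adm e₂ s₂ d₂) :
    Jval A₁ e₁ s₁ d₁ = Jval A₂ e₂ s₂ d₂ := by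
  -- a common admissible `(s, d)`
  have ha₁ : Adm e₁ (s₁ + s₂) (d₁ + d₂ + (s₁ + s₂)) := fun i ↦ ⟨by have := (hs₁ i).1; push_cast; omega, by have := (hs₁ i).2; push_cast; omega⟩
  have ha₂ : Adm e₂ (s₁ + s₂) (d₁ + d₂ + (s₁ + s₂)) := fun i ↦ ⟨by have := (hs₂ i).1; push_cast; omega, by have := (hs₂ i).2; push_cast; omega⟩
  have haY : Adm (Sum.elim e₁ e₂) (s₁ + s₂) (d₁ + d₂ + (s₁ + s₂)) := by rintro (i | i); exacts [ha₁ i, ha₂ i]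
  rw [Jval_indep A₁ hs₁ ha₁ (h₁.isUnit hg), Jval_indep A₂ hs₂ ha₂ (h₂.isUnit hg)]
  -- the segment over `X × [0,1]`
  have hY : IsUnit (laurentMatrix (segA A₁ A₂) (Sum.elim e₁ e₂)) := isUnit_laurentMatrix_segA hg h₁ h₂
  have hlin := isUnit_linClutch_lcoeff (segA A₁ A₂) haY hY
  have e0 := pullback_Jval (segA A₁ A₂) (Sum.elim e₁ e₂) (s₁ + s₂) (d₁ + d₂ + (s₁ + s₂)) (sliceIncl 0) hlin
  have e1 := pullback_Jval (segA A₁ A₂) (Sum.elim e₁ e₂) (s₁ + s₂) (d₁ + d₂ + (s₁ + s₂)) (sliceIncl 1) hlin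
  rw [pullback_eq_of_homotopic (sliceIncl_homotopic 0 1), e1, segA_slice_zero, Jval_congr_lcoeff (lcoeff_sum_elim_zero_right A₁ e₁ e₂ _ _)] at e0
  rw [← e0, segA_slice_one, Jval_congr_lcoeff (lcoeff_sum_elim_zero_left A₂ e₁ e₂ _ _)]

end Approx

/-! ### The index of an invertible matrix over `X × S¹` -/

section IndGL

attribute [local instance] Matrix.linftyOpNormedRing Matrix.linftyOpNormedAlgebra

/-- A chosen admissible approximant. [folklore] -/
structure ApproxData (g : Matrix (Fin n) (Fin n) C(↥(pieceUp X ∩ pieceDn X), ℂ)) where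
  /-- index type of the monomials -/
  ι' : Type
  /-- finiteness -/
  [fin : Fintype ι']
  /-- coefficients -/
  A : ι' → Matrix (Fin n) (Fin n) C(X, ℂ)
  /-- exponents -/
  e : ι' → ℤ
  /-- admissibility -/
  approx : IsApprox g A e

attribute [instance] ApproxData.fin

/-- Auxiliary statement for the index map of Bott periodicity. [folklore] -/
theorem nonempty_approxData (g : Matrix (Fin n) (Fin n) C(↥(pieceUp X ∩ pieceDn X), ℂ)) : Nonempty (ApproxData g) := by
  obtain ⟨ι', _, A, e, h⟩ := exists_isApprox g
  exact ⟨⟨ι', A, e, h⟩⟩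

/-- The chosen approximant of `g`. [folklore] -/
def chosenApprox (g : Matrix (Fin n) (Fin n) C(↥(pieceUp X ∩ pieceDn X), ℂ)) : ApproxData g := Classical.choice (nonempty_approxData g)

omit [CompactSpace X] [T2Space X] in
/-- `(laurentShift e, laurentDeg e)` is admissible. [folklore] -/
theorem adm_laurentShift {ι' : Type} [Fintype ι'] (e : ι' → ℤ) : Adm e (laurentShift e) (laurentDeg e) := fun i ↦
  ⟨le_laurentShift e i, by
    have h1 := toNat_lt_laurentDeg_succ e i
    have h2 := Int.self_le_toNat (e i + laurentShift e)
    omega⟩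

/-- **The index `ind(g) ∈ K⁰(X)` of an invertible matrix over `X × S¹`**:
`ind(g) = [Lᵈ(zˢ L)₊] - s·n` for any admissible Laurent approximant `L` of `g`
(Husemöller's `ν`, normalised). [cite: HusemollerFibreBundles1994, Ch. 11 Thm. 5.4] -/
def indGL (g : Matrix (Fin n) (Fin n) C(↥(pieceUp X ∩ pieceDn X), ℂ)) : K0 X :=
  Jval (chosenApprox g).A (chosenApprox g).e (laurentShift (chosenApprox g).e) (laurentDeg (chosenApprox g).e)

/-- **`ind(g)` is computed by any admissible approximant and any admissible `(s, d)`.** [cite: HusemollerFibreBundles1994, Ch. 11 Props. 5.2–5.3] -/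
theorem indGL_eq {g : Matrix (Fin n) (Fin n) C(↥(pieceUp X ∩ pieceDn X), ℂ)} (hg : IsUnit g) {ι' : Type} [Fintype ι']
    {A : ι' → Matrix (Fin n) (Fin n) C(X, ℂ)} {e : ι' → ℤ} (h : IsApprox g A e) {s d : ℕ} (hsd : Adm e s d) : indGL g = Jval A e s d :=
  Jval_eq_of_isApprox hg (chosenApprox g).approx h (adm_laurentShift _) hsd

/-! ### `ind(1) = 0` -/

omit [CompactSpace X] [T2Space X] in
/-- Auxiliary statement for the index map of Bott periodicity. [folklore] -/
theorem laurentMatrix_const_one : laurentMatrix (fun _ : Unit ↦ (1 : Matrix (Fin n) (Fin n) C(X, ℂ))) (fun _ ↦ 0) = 1 := by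
  rw [laurentMatrix, Fintype.sum_unique, zpow_zero, Units.val_one, one_smul, Matrix.map_one _ (map_zero _) (map_one _)]

/-- **`ind(1) = 0`.** [cite: HusemollerFibreBundles1994, Ch. 11 Thm. 5.4] -/
theorem indGL_one : indGL (1 : Matrix (Fin n) (Fin n) C(↥(pieceUp X ∩ pieceDn X), ℂ)) = 0 := by
  have happ : IsApprox (1 : Matrix (Fin n) (Fin n) C(↥(pieceUp X ∩ pieceDn X), ℂ)) (fun _ : Unit ↦ (1 : Matrix (Fin n) (Fin n) C(X, ℂ))) (fun _ ↦ 0) := by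
    rw [IsApprox, laurentMatrix_const_one, sub_self, norm_zero]; exact eps0_pos _
  have hadm : Adm (fun _ : Unit ↦ (0 : ℤ)) 0 0 := fun _ ↦ ⟨le_rfl, le_rfl⟩
  rw [indGL_eq isUnit_one happ hadm]
  have hb : linB (lcoeff (fun _ : Unit ↦ (1 : Matrix (Fin n) (Fin n) C(X, ℂ))) (fun _ ↦ 0) 0 0) = 1 := by
    rw [linB, ← Matrix.comp_one]
    congr 1
    ext r c : 1
    have hr : r = 0 := Fin.fin_one_eq_zero r
    have hc : c = 0 := Fin.fin_one_eq_zero c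
    subst hr hc
    simp [LmatA, lcoeff]
  have ha : linA X 0 n = 0 := by
    rw [linA]
    have : LmatB 0 (Fin n) C(X, ℂ) = 0 := by
      ext r c : 1
      have hr : r = 0 := Fin.fin_one_eq_zero r
      have hc : c = 0 := Fin.fin_one_eq_zero c
      subst hr hc
      simp [LmatB]
    rw [this]; rfl
  have h01 : IsUnit (linClutch (0 : Matrix (Fin 1 × Fin n) (Fin 1 × Fin n) C(X, ℂ)) 1) := by
    rw [linClutch, liftA, liftA, Matrix.map_zero _ (map_zero _), smul_zero, zero_add, Matrix.map_one _ (map_zero _) (map_one _)]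
    exact isUnit_one
  have h : IsUnit (linClutch (linA X 0 n) (linB (lcoeff (fun _ : Unit ↦ (1 : Matrix (Fin n) (Fin n) C(X, ℂ))) (fun _ ↦ 0) 0 0))) := by
    rw [ha, hb]; exact h01
  rw [Jval_eq _ h, plusClass_congr h h01 ha hb, plusClass_zero_left]
  simp

/-! ### Base change and homotopy invariance of `ind` -/

variable {X' : Type*} [TopologicalSpace X'] [CompactSpace X'] [T2Space X']

omit [T2Space X] [T2Space X'] in
/-- `‖(f^*g)⁻¹‖ ≤ ‖g⁻¹‖`. [folklore] -/
theorem norm_inverse_map_le {g : Matrix (Fin n) (Fin n) C(↥(pieceUp X ∩ pieceDn X), ℂ)} (hg : IsUnit g) (f : C(X', X)) :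
    ‖Ring.inverse (g.map (comapRingHom (ovlMap X f)))‖ ≤ ‖Ring.inverse g‖ := by
  obtain ⟨u, rfl⟩ := hg
  have h1 : (↑u : Matrix (Fin n) (Fin n) _).map (comapRingHom (ovlMap X f)) * (↑u⁻¹ : Matrix (Fin n) (Fin n) _).map (comapRingHom (ovlMap X f)) = 1 := by
    rw [← Matrix.map_mul, Units.mul_inv, Matrix.map_one _ (map_zero _) (map_one _)]
  have h2 : (↑u⁻¹ : Matrix (Fin n) (Fin n) _).map (comapRingHom (ovlMap X f)) * (↑u : Matrix (Fin n) (Fin n) _).map (comapRingHom (ovlMap X f)) = 1 := by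
    rw [← Matrix.map_mul, Units.inv_mul, Matrix.map_one _ (map_zero _) (map_one _)]
  rw [Ring.inverse_unit u, Ring.inverse_unit ⟨_, _, h1, h2⟩]
  exact linfty_opNorm_map_comapRingHom_le _ _

omit [T2Space X] [T2Space X'] in
/-- **Admissible approximants pull back to admissible approximants.** [folklore] -/
theorem IsApprox.map {g : Matrix (Fin n) (Fin n) C(↥(pieceUp X ∩ pieceDn X), ℂ)} (hg : IsUnit g) {ι' : Type} [Fintype ι']
    {A : ι' → Matrix (Fin n) (Fin n) C(X, ℂ)} {e : ι' → ℤ} (h : IsApprox g A e) (f : C(X', X)) :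
    IsApprox (g.map (comapRingHom (ovlMap X f))) (fun i ↦ (A i).map (comapRingHom f)) e := by
  rw [IsApprox, ← laurentMatrix_map, ← Matrix.map_sub _ (map_sub _)]
  exact (linfty_opNorm_map_comapRingHom_le _ _).trans_lt (h.trans_le (eps0_le_eps0 (norm_inverse_map_le hg f)))

/-- **`ind` is natural**: `f^* ind(g) = ind(f^* g)`. [cite: HusemollerFibreBundles1994, Ch. 11 Prop. 5.3] -/
theorem pullback_indGL {g : Matrix (Fin n) (Fin n) C(↥(pieceUp X ∩ pieceDn X), ℂ)} (hg : IsUnit g) (f : C(X', X)) :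
    pullback f (indGL g) = indGL (g.map (comapRingHom (ovlMap X f))) := by
  have happ := (chosenApprox g).approx
  have hadm := adm_laurentShift (chosenApprox g).e
  have hg' : IsUnit (g.map (comapRingHom (ovlMap X f))) := hg.map (RingHom.mapMatrix _)
  rw [indGL, pullback_Jval _ _ _ _ f (isUnit_linClutch_lcoeff _ hadm (happ.isUnit hg)), indGL_eq hg' (happ.map hg f) hadm]

/-- **Homotopy invariance of `ind`**: the slices of an invertible matrix over `(X × [0,1]) × S¹`
have the same index. [cite: HusemollerFibreBundles1994, Ch. 11 Prop. 5.3] -/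
theorem indGL_slice_eq {G : Matrix (Fin n) (Fin n) C(↥(pieceUp (X × I) ∩ pieceDn (X × I)), ℂ)} (hG : IsUnit G) (s t : I) :
    indGL (G.map (comapRingHom (sliceOverlap s))) = indGL (G.map (comapRingHom (sliceOverlap t))) := by
  have hs := pullback_indGL hG (sliceIncl s)
  have ht := pullback_indGL hG (sliceIncl t)
  rw [pullback_eq_of_homotopic (sliceIncl_homotopic s t), ht] at hs
  exact hs.symm

/-! ### `ind(z P + (1 - P)) = [P]` -/

omit [CompactSpace X] [T2Space X] in
/-- `w E + (1 - E)` is invertible for an idempotent `E` and `w ≠ 0`. [folklore] -/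
theorem isUnit_pencil_idem {E : Matrix (Fin n) (Fin n) ℂ} (hE : E * E = E) {w : ℂ} (hw : w ≠ 0) : IsUnit (pencil E (1 - E) w) := by
  have h1 : (1 - E) * E = 0 := by rw [Matrix.sub_mul, Matrix.one_mul, hE, sub_self]
  have h2 : E * (1 - E) = 0 := by rw [Matrix.mul_sub, Matrix.mul_one, hE, sub_self]
  have h3 : (1 - E) * (1 - E) = 1 - E := by rw [Matrix.mul_sub, Matrix.mul_one, h1, sub_zero]
  have key : ∀ a b : ℂ, a * b = 1 → pencil E (1 - E) a * pencil E (1 - E) b = 1 := by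
    intro a b hab
    rw [pencil, pencil, Matrix.add_mul, Matrix.mul_add, Matrix.mul_add, Matrix.smul_mul, Matrix.mul_smul, Matrix.smul_mul, Matrix.mul_smul,
      hE, h1, h2, h3, smul_zero, smul_zero, add_zero, zero_add, smul_smul, hab, one_smul, add_sub_cancel]
  exact ⟨⟨_, _, key w w⁻¹ (mul_inv_cancel₀ hw), key w⁻¹ w (inv_mul_cancel₀ hw)⟩, rfl⟩

omit [CompactSpace X] [T2Space X] in
/-- `z P + (1 - P)` is invertible over `X × S¹`. [cite: HusemollerFibreBundles1994, Ch. 11 Cor. 2.8] -/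
theorem isUnit_linClutch_idem {e₀ : Matrix (Fin n) (Fin n) C(X, ℂ)} (he : IsIdempotentElem e₀) : IsUnit (linClutch e₀ (1 - e₀)) := by
  refine isUnit_of_forall_isUnit_evalAt _ fun z ↦ ?_
  rw [evalAt_linClutch, evalAt_sub, evalAt_one]
  refine isUnit_pencil_idem ?_ (by intro h0; have := norm_zA z; rw [h0, norm_zero] at this; exact zero_ne_one this)
  have := congrArg (fun M ↦ evalAt M z.1.1) he.eq
  rwa [evalAt_mul] at this

/-- The exact Laurent data of `z P + (1 - P)`. [folklore] -/
def spData (e₀ : Matrix (Fin n) (Fin n) C(X, ℂ)) : Bool → Matrix (Fin n) (Fin n) C(X, ℂ) := fun b ↦ if b then e₀ else 1 - e₀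

/-- The exponents `(1, 0)`. [folklore] -/
def spExp : Bool → ℤ := fun b ↦ if b then 1 else 0

omit [CompactSpace X] [T2Space X] in
/-- Auxiliary statement for the index map of Bott periodicity. [folklore] -/
theorem laurentMatrix_spData (e₀ : Matrix (Fin n) (Fin n) C(X, ℂ)) : laurentMatrix (spData e₀) spExp = linClutch e₀ (1 - e₀) := by
  rw [laurentMatrix, Fintype.sum_bool]
  simp [spData, spExp, linClutch, liftA]

omit [CompactSpace X] [T2Space X] in
/-- Auxiliary statement for the index map of Bott periodicity. [folklore] -/
theorem adm_spExp : Adm spExp 0 1 := by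
  rintro (_ | _) <;> simp [spExp]

omit [CompactSpace X] [T2Space X] in
/-- Auxiliary statement for the index map of Bott periodicity. [folklore] -/
theorem lcoeff_spData_zero (e₀ : Matrix (Fin n) (Fin n) C(X, ℂ)) : lcoeff (spData e₀) spExp 0 1 0 = 1 - e₀ := by
  rw [lcoeff, Finset.sum_filter, Fintype.sum_bool]; simp [spExp, spData]

omit [CompactSpace X] [T2Space X] in
/-- Auxiliary statement for the index map of Bott periodicity. [folklore] -/
theorem lcoeff_spData_one (e₀ : Matrix (Fin n) (Fin n) C(X, ℂ)) : lcoeff (spData e₀) spExp 0 1 1 = e₀ := by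
  rw [lcoeff, Finset.sum_filter, Fintype.sum_bool]; simp [spExp, spData]

/-- `Fin n ⊕ Fin n ≃ Fin 2 × Fin n`: `inl i ↦ (0, i)`, `inr i ↦ (1, i)`. [folklore] -/
def E2 (n : ℕ) : Fin n ⊕ Fin n ≃ Fin 2 × Fin n where
  toFun := Sum.elim (fun i ↦ (0, i)) (fun i ↦ (1, i))
  invFun p := if p.1 = 0 then Sum.inl p.2 else Sum.inr p.2
  left_inv := by rintro (i | i) <;> simp
  right_inv := by
    rintro ⟨r, i⟩
    fin_cases r <;> simp

omit [CompactSpace X] [T2Space X] in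
/-- `Matrix.comp` of a `2 × 2` block matrix is `fromBlocks`, re-indexed. [folklore] -/
theorem comp_fin_two {R : Type*} (M : Matrix (Fin 2) (Fin 2) (Matrix (Fin n) (Fin n) R)) :
    Matrix.comp _ _ _ _ _ M = Matrix.reindex (E2 n) (E2 n) (Matrix.fromBlocks (M 0 0) (M 0 1) (M 1 0) (M 1 1)) := by
  ext ⟨r, i⟩ ⟨c, j⟩
  fin_cases r <;> fin_cases c <;> rfl

omit [CompactSpace X] [T2Space X] in
/-- Auxiliary statement for the index map of Bott periodicity. [folklore] -/
theorem linB_lcoeff_spData (e₀ : Matrix (Fin n) (Fin n) C(X, ℂ)) : linB (lcoeff (spData e₀) spExp 0 1) = Matrix.reindex (E2 n) (E2 n) (spAX e₀) := by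
  rw [linB, comp_fin_two, spAX]
  congr 1
  simp only [LmatA, Matrix.of_apply, lcoeff_spData_zero, lcoeff_spData_one]
  rfl

omit [CompactSpace X] [T2Space X] in
/-- Auxiliary statement for the index map of Bott periodicity. [folklore] -/
theorem linA_one_eq : linA X 1 n = Matrix.reindex (E2 n) (E2 n) (spBX X n) := by
  rw [linA, comp_fin_two, spBX]
  congr 1

/-- **`ind(z P + (1 - P)) = [P]`** (Husemöller: `L(P, z)₊ = im P`). [cite: HusemollerFibreBundles1994, Ch. 11 Thm. 5.4] -/
theorem indGL_sp {e₀ : Matrix (Fin n) (Fin n) C(X, ℂ)} (he : IsIdempotentElem e₀) :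
    indGL (linClutch e₀ (1 - e₀)) = KZero.of (⟨n, e₀, he⟩ : Idem C(X, ℂ)) := by
  have hg := isUnit_linClutch_idem he
  have happ : IsApprox (linClutch e₀ (1 - e₀)) (spData e₀) spExp := by
    rw [IsApprox, laurentMatrix_spData, sub_self, norm_zero]; exact eps0_pos _
  rw [indGL_eq hg happ adm_spExp]
  have h := isUnit_linClutch_lcoeff (spData e₀) adm_spExp (by rw [laurentMatrix_spData]; exact hg)
  have h' : IsUnit (linClutch (spBX X n) (spAX e₀)) := by
    have := isUnit_linClutch_reindex (E2 n).symm h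
    rwa [linA_one_eq, linB_lcoeff_spData, Matrix.reindex_apply, Matrix.reindex_apply, Matrix.reindex_apply, Matrix.reindex_apply,
      Matrix.submatrix_submatrix, Matrix.submatrix_submatrix, Equiv.symm_symm, Equiv.symm_comp_self, Matrix.submatrix_id_id,
      Matrix.submatrix_id_id] at this
  rw [Jval_eq _ h, plusClass_congr h ((linA_one_eq (X := X) (n := n)) ▸ (linB_lcoeff_spData e₀) ▸ h) linA_one_eq (linB_lcoeff_spData e₀),
    plusClass_reindex _ _ _ h', plusClass_sp e₀ he h']
  simp

end IndGL

end Literature.AlgebraicTopology.KTheory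

end
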